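import Summits.ResolutionOfSingularities.ResolutionOfSingularities.Theorems.RadicialJungCleanModelsCcurveModelWithT
import Summits.ResolutionOfSingularities.ResolutionOfSingularities.Theorems.RadicialJungCleanModelsCleanLU3CompositeDivisorialHeight
import Literature.AlgebraicGeometry.Resolution.QuadraticTransforms
import HarnessLib

/-!
# Route `RadicialJung`, crux `CleanModels` (stmt-15917) — (C-curve) sub-line, brick S0b: a model on which the centre of the proper coarsening is a CURVE

Lead `res-B-lead-1` g6 (plan `Cruxes/CleanModels/Lines/Sketch-memo-Ccurve-plan.md` §0/§1 S0; the `B`-half of `stub_Cc_rebaseD2`).  OURS · counted 0.  Nothing here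
proves resolution in characteristic `p`; resolution in char `p` is NOT proved; `CossartPiltant2019` (F-02) is a PRINTED theorem typed as a hypothesis.

Setting of the research stub :249‴ with a PROPER coarsening `O < O₁ < K` and «no divisorial coarsening».  Then:
* `exists_mem_maximalIdeal_valuation_eq_one` — some `t ∈ 𝔪_O` is an `O₁`-unit (`t = s⁻¹` for `s ∈ O₁ ∖ O`);
* `exists_model_coarseCentre_curve` — (mod F-02) a model `B ⊇ A` inside `O`, regular of dimension 3 at the centre of `O`, containing such a `t`, whose local ring at the
  centre of `O₁` is regular (Serre) of dimension EXACTLY 2 with fraction field `K` (`IsLocalRingOf`): the centre `𝔮` of `O₁` on `B` lies strictly below the centre of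
  `O` (it misses `t`), so `dim B/𝔮 ≥ 1`, and `dim B/𝔮 ≤ 1` because a transcendence basis of `B/𝔮 ⊆ κ(O₁)` with two members would be a residually independent pair
  — excluded by «no divisorial coarsening»; the affine dimension formula `dim B/𝔮 + ht 𝔮 = 3` gives `ht 𝔮 = 2`.
-/

noncomputable section

set_option linter.dupNamespace false

open IsLocalRing AlgebraicGeometry
open Literature.AlgebraicGeometry.Resolution

namespace Summit.ResolutionOfSingularities.ResolutionOfSingularities.Theorems.RadicialJung.CleanModels.Ccurve

variable {K : Type} [Field K]

/-- For valuation rings `O < O₁` of `K`, some element of the maximal ideal of `O` is a unit of `O₁` (the inverse of any `s ∈ O₁ ∖ O`). [folklore] -/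
theorem exists_mem_maximalIdeal_valuation_eq_one (O O₁ : ValuationSubring K) (hOO₁ : O ≤ O₁) (hne : O₁ ≠ O) :
    ∃ t : K, t ∈ O ∧ O.valuation t < 1 ∧ O₁.valuation t = 1 := by
  obtain ⟨s, hs₁, hs⟩ := SetLike.exists_of_lt (lt_of_le_of_ne hOO₁ (Ne.symm hne))
  have hs0 : s ≠ 0 := by rintro rfl; exact hs O.zero_mem
  have hinv : s⁻¹ ∈ O := (O.mem_or_inv_mem s).resolve_left hs
  refine ⟨s⁻¹, hinv, ?_, ?_⟩
  · rw [map_inv₀, inv_lt_one₀ (zero_lt_iff.mpr ((Valuation.ne_zero_iff _).mpr hs0))]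
    exact lt_of_not_ge fun h => hs ((O.valuation_le_one_iff s).mp h)
  · apply le_antisymm ((O₁.valuation_le_one_iff _).mpr (hOO₁ hinv))
    rw [map_inv₀, one_le_inv₀ (zero_lt_iff.mpr ((Valuation.ne_zero_iff _).mpr hs0))]
    exact (O₁.valuation_le_one_iff s).mpr hs₁

variable {k : Type} [Field k] [Algebra k K]

/-- **A model on which the centre of the proper coarsening `O₁` is a curve** (mod F-02).  See the module docstring. [folklore] -/
theorem exists_model_coarseCentre_curve (hCP : CossartPiltant2019.{0})
    (O : ValuationSubring K) (A : Subalgebra k K) (hAO : A.toSubring ≤ O.toSubring) (hAfg : A.FG) (hfr : IsFractionRing A K)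
    (hdim3 : ringKrullDim (locAtCentre A.toSubring O) = 3)
    (hzd : ∀ (T : Subring K) (hT : T ≤ O.toSubring), A.toSubring ≤ T → (subringCentre T O hT).IsMaximal)
    (hdiv : ¬ (∃ (O₁ : ValuationSubring K), O ≤ O₁ ∧ O₁ ≠ ⊤ ∧ ∃ y : Fin 2 → K, (∀ i, y i ∈ O) ∧
      ∀ P : MvPolynomial (Fin 2) k, P ≠ 0 → O₁.valuation (MvPolynomial.aeval y P) = 1))
    (O₁ : ValuationSubring K) (hOO₁ : O ≤ O₁) (hne : O₁ ≠ O) (hO₁ : O₁ ≠ ⊤) :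
    ∃ (B : Subalgebra k K) (_ : B.toSubring ≤ O.toSubring), A ≤ B ∧ B.FG ∧
      IsRegularLocalRing (locAtCentre B.toSubring O) ∧ ringKrullDim (locAtCentre B.toSubring O) = 3 ∧
      IsRegularLocalRing (locAtCentre B.toSubring O₁) ∧ ringKrullDim (locAtCentre B.toSubring O₁) = 2 ∧
      IsLocalRingOf (locAtCentre B.toSubring O₁) ∧
      ∃ t : K, t ∈ B ∧ O.valuation t < 1 ∧ O₁.valuation t = 1 := by
  classical
  haveI := hfr
  -- the element `t` and the model `B ∋ t`
  obtain ⟨t, htO, hvt, hv₁t⟩ := exists_mem_maximalIdeal_valuation_eq_one O O₁ hOO₁ hne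
  have hdimA : ringKrullDim A = (3 : ℕ) := by
    rw [← ringKrullDim_locAtCentre_eq_of_isMaximal A hAfg O hAO (hzd _ hAO le_rfl)]; exact hdim3
  obtain ⟨B, hBO, hAB, hBfg, htB, hregB, hdimB⟩ :=
    exists_regular_model_mem_of_cossartPiltant2019 hCP k K O A hAO hAfg hfr hdimA le_rfl hzd t htO
  have hBO₁ : B.toSubring ≤ O₁.toSubring := fun z hz => hOO₁ (hBO hz)
  haveI hfrB : IsFractionRing B K := isFractionRing_of_le hAB hfr
  -- regularity at the centre of `O₁`
  have hregB₁ : IsRegularLocalRing (locAtCentre B.toSubring O₁) := isRegularLocalRing_locAtCentre_of_le hOO₁ B.toSubring hBO hregB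
  -- dimension bookkeeping
  letI : Algebra k B.toSubring := inferInstanceAs (Algebra k B)
  haveI : Algebra.FiniteType k B.toSubring := (B.fg_iff_finiteType.mp hBfg : Algebra.FiniteType k B)
  haveI := isLocalization_locAtCentre (K := K) (O := O₁) hBO₁
  set 𝔮 := subringCentre B.toSubring O₁ hBO₁ with h𝔮
  have h1 : ringKrullDim (locAtCentre B.toSubring O₁) = 𝔮.height :=
    IsLocalization.AtPrime.ringKrullDim_eq_height 𝔮 (locAtCentre B.toSubring O₁)
  have hdimB' : ringKrullDim B.toSubring = (3 : ℕ) := by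
    change ringKrullDim B = _
    rw [← ringKrullDim_locAtCentre_eq_of_isMaximal B hBfg O hBO (hzd _ hBO (fun z hz => hAB hz))]; exact hdimB
  have h2 := Literature.RingTheory.KrullDimension.ringKrullDim_quotient_add_height k (A := B.toSubring) 𝔮
  haveI : IsDomain (B.toSubring ⧸ 𝔮) := Ideal.Quotient.isDomain 𝔮
  obtain ⟨s, hs, htr⟩ := Literature.RingTheory.KrullDimension.exists_ringKrullDim_eq_and_trdeg_eq k (B.toSubring ⧸ 𝔮)
  -- the height of `𝔮` as a natural number, `s + n = d = 3`
  obtain ⟨d, hd, hd3⟩ : ∃ d : ℕ, ringKrullDim B.toSubring = d ∧ d = 3 := ⟨3, hdimB', rfl⟩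
  have hle := Ideal.height_le_ringKrullDim_of_ne_top (Ideal.IsPrime.ne_top (inferInstance : 𝔮.IsPrime))
  rw [hd] at hle
  have hle' : 𝔮.height ≤ d := by exact_mod_cast hle
  obtain ⟨n, hn⟩ := ENat.ne_top_iff_exists.1 (ne_top_of_le_ne_top (ENat.coe_ne_top d) hle')
  rw [hs, hd, ← hn] at h2
  have hsn : s + n = d := by exact_mod_cast h2
  -- `𝔮` lies below the centre `𝔪` of `O`, strictly (it misses `t`)
  have ht𝔮 : (⟨t, htB⟩ : B.toSubring) ∉ 𝔮 := by
    rw [h𝔮, mem_subringCentre_iff]; exact fun h => (lt_irrefl _) (hv₁t ▸ h)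
  have h𝔮𝔪 : 𝔮 ≤ subringCentre B.toSubring O hBO := by
    intro x hx
    rw [h𝔮, mem_subringCentre_iff] at hx
    rw [mem_subringCentre_iff]
    by_contra hx'
    have hx1 : O.valuation (x : K) = 1 := le_antisymm ((O.valuation_le_one_iff _).mpr (hBO x.2)) (not_lt.mp hx')
    have hx0 : (x : K) ≠ 0 := ne_zero_of_valuation_eq_one hx1
    have hinv : (x : K)⁻¹ ∈ O := by rw [← O.valuation_le_one_iff, map_inv₀, hx1, inv_one]
    have h1 : O₁.valuation (x : K)⁻¹ ≤ 1 := (O₁.valuation_le_one_iff _).mpr (hOO₁ hinv)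
    rw [map_inv₀, inv_le_one₀ (zero_lt_iff.mpr ((Valuation.ne_zero_iff _).mpr hx0))] at h1
    exact (lt_irrefl _) (lt_of_lt_of_le hx h1)
  -- (a) `s ≥ 1`: else `𝔮` is maximal, hence equal to the centre of `O`, which contains `t`
  have hs1 : 1 ≤ s := by
    by_contra hs0
    push Not at hs0
    have hs0' : s = 0 := by omega
    haveI : Ring.KrullDimLE 0 (B.toSubring ⧸ 𝔮) := by
      rw [Ring.krullDimLE_iff, hs, hs0']
    have hfield : IsField (B.toSubring ⧸ 𝔮) := Ring.KrullDimLE.isField_of_isDomain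
    have hmax : 𝔮.IsMaximal := Ideal.Quotient.maximal_of_isField 𝔮 hfield
    have heq : 𝔮 = subringCentre B.toSubring O hBO :=
      hmax.eq_of_le (Ideal.IsPrime.ne_top inferInstance) h𝔮𝔪
    apply ht𝔮
    rw [heq, mem_subringCentre_iff]; exact hvt
  -- (b) `s ≤ 1`: else a transcendence basis of `B/𝔮` over `k` has two members — a residually independent pair, excluded by `hdiv`
  have hs2 : s ≤ 1 := by
    by_contra hs2
    push Not at hs2
    haveI : FaithfulSMul k (B.toSubring ⧸ 𝔮) :=
      (faithfulSMul_iff_algebraMap_injective k (B.toSubring ⧸ 𝔮)).mpr (algebraMap k (B.toSubring ⧸ 𝔮)).injective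
    obtain ⟨sB, hsB⟩ := exists_isTranscendenceBasis k (B.toSubring ⧸ 𝔮)
    have hcard : (2 : Cardinal) ≤ Cardinal.mk sB := by
      rw [hsB.cardinalMk_eq_trdeg, htr]; exact_mod_cast hs2
    obtain ⟨a, b, hab⟩ := Cardinal.two_le_iff.mp hcard
    let f : Fin 2 → sB := ![a, b]
    have hf : Function.Injective f := by
      intro i j hij
      fin_cases i <;> fin_cases j
      · rfl
      · exact absurd hij hab
      · exact absurd hij.symm hab
      · rfl
    have hind2 : AlgebraicIndependent k (fun i => ((f i : sB) : B.toSubring ⧸ 𝔮)) := hsB.1.comp f hf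
    -- lift the pair to `B`
    have hlift : ∀ i : Fin 2, ∃ y' : B.toSubring, Ideal.Quotient.mk 𝔮 y' = ((f i : sB) : B.toSubring ⧸ 𝔮) :=
      fun i => Ideal.Quotient.mk_surjective _
    choose y' hy' using hlift
    let y : Fin 2 → K := fun i => (y' i : K)
    apply hdiv
    refine ⟨O₁, hOO₁, hO₁, y, fun i => hBO (y' i).2, fun P hP => ?_⟩
    -- `aeval y P ∈ B ∖ 𝔮`
    let ιB : B.toSubring →ₐ[k] K := B.val
    have hval : ((MvPolynomial.aeval y' P : B.toSubring) : K) = MvPolynomial.aeval y P := by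
      change ιB (MvPolynomial.aeval y' P) = _
      rw [← AlgHom.comp_apply, MvPolynomial.comp_aeval]
      rfl
    have hnot : (MvPolynomial.aeval y' P : B.toSubring) ∉ 𝔮 := by
      intro hmem
      have h0 : MvPolynomial.aeval (fun i => ((f i : sB) : B.toSubring ⧸ 𝔮)) P = 0 := by
        have : (fun i => ((f i : sB) : B.toSubring ⧸ 𝔮)) = fun i => Ideal.Quotient.mkₐ k 𝔮 (y' i) := by
          funext i; rw [Ideal.Quotient.mkₐ_eq_mk, hy']
        rw [this, ← MvPolynomial.comp_aeval, AlgHom.comp_apply, Ideal.Quotient.mkₐ_eq_mk, Ideal.Quotient.eq_zero_iff_mem]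
        exact hmem
      exact hP ((algebraicIndependent_iff.mp hind2) P h0)
    rw [← hval]
    exact valuation_eq_one_of_not_mem_subringCentre hBO₁ hnot
  -- conclusion
  have hs' : s = 1 := le_antisymm hs2 hs1
  have hn2 : n = 2 := by omega
  have hdim2 : ringKrullDim (locAtCentre B.toSubring O₁) = 2 := by
    rw [h1, ← hn, hn2]; rfl
  have hof : IsLocalRingOf (locAtCentre B.toSubring O₁) := by
    refine ⟨isLocalRing_locAtCentre hBO₁, fun z => ?_⟩
    obtain ⟨a, b, hb, rfl⟩ := IsFractionRing.div_surjective (A := B) z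
    refine ⟨a, le_locAtCentre _ _ a.2, b, le_locAtCentre _ _ b.2, ?_, rfl⟩
    exact fun h => nonZeroDivisors.ne_zero hb (Subtype.ext h)
  exact ⟨B, hBO, hAB, hBfg, hregB, hdimB, hregB₁, hdim2, hof, t, htB, hvt, hv₁t⟩

end Summit.ResolutionOfSingularities.ResolutionOfSingularities.Theorems.RadicialJung.CleanModels.Ccurve

end
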